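import Summits.HodgeConjecture.HodgeConjecture.Theses.SevenfoldWeilCensus
import Literature.AlgebraicGeometry.HodgeTheory.SimplePrimeDimensionHodgeClasses
import HarnessLib

/-!
# Route `SevenfoldWeilCensus`, crux X1 `CodimThreeWeilGeneration` — the Tankeev–Ribet sector (simple SEVENFOLDS) modulo the named fact

Helper of stmt-HodgeConjecture-18720 (`Theses.SevenfoldWeilCensus.CodimThreeWeilGeneration`, crux X1 of the
route `SevenfoldWeilCensus`). The registered skeleton `Cruxes/CodimThreeWeilGeneration/Lines/birth.lean`
cuts X1 into three sectors; its first stub `stub_simple_prime_seven` — on a SIMPLE complex abelian variety of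
dimension `7` every rational `(3,3)`-class lies in `D³ ⊗ ℂ = divisorClassesSpan A.X A.dim 3` — is, as that
file says, "a theorem in print, not in the tree (no `Literature` fact names it yet)": Tankeev 1982 / Ribet
1983, `B•(Xⁿ) = D•(Xⁿ)` for simple `X` of PRIME dimension (`7` is prime). The fact is now vendored
(`Literature/AlgebraicGeometry/HodgeTheory/SimplePrimeDimensionHodgeClasses`, p177550:
`TankeevRibet1983_hodgeClasses_divisorial_powers_simplePrimeDimension`, Moonen–Zarhin Math. Ann. 315 (1999)
Thm. (2.7) verbatim), and this file records the one-line bridge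

  `codimThreeWeilGeneration_stub_simple_prime_seven_of_tankeevRibet :
      TankeevRibet1983_… → <signature of stub_simple_prime_seven, verbatim>`

(instance `p = 7`, `N = 0`, `m = 3` of the fact). It is CONDITIONAL on the named fact (a `conditional-result`:
the stub itself stays open until the fact is discharged in the tree — sized L in the skeleton's docstring:
Mumford–Tate groups of type I(e | 7) / IV sevenfolds + invariant theory), so it does not close the stub; it
pins the stub to exactly one refereed theorem. B2b ladder `hodge-weil`, prover 3 gen 4 (classical special
cases); no `sorry`, no definition, axioms standard.
-/

noncomputable section

-- every declaration of this problem lives in Summit.HodgeConjecture.HodgeConjecture.… (summit = sub-problem)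
set_option linter.dupNamespace false

open CategoryTheory
open Literature.AlgebraicGeometry Literature.AlgebraicGeometry.Motives
open Literature.AlgebraicGeometry.HodgeTheory

namespace Summit.HodgeConjecture.HodgeConjecture.Theorems

/-- **X1, Tankeev–Ribet sector, modulo the named fact**: granted
`TankeevRibet1983_hodgeClasses_divisorial_powers_simplePrimeDimension` (Moonen–Zarhin 1999 Thm. (2.7):
`B•(Xⁿ) = D•(Xⁿ)` for simple `X` of prime dimension), the registered stub `stub_simple_prime_seven` of
`Cruxes/CodimThreeWeilGeneration/Lines/birth.lean` holds VERBATIM: on a simple complex abelian SEVENFOLD every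
rational `(3,3)`-class lies in `divisorClassesSpan A.X A.dim 3` (`7` is prime; instance `N = 0`, `m = 3`,
`hodgeClasses_divisorial_self_of_tankeevRibet`). [cite: MoonenZarhin1999LowDim, §2 Thm. (2.7)]
[cite: vanGeemen1994HodgeAV, Thm. 4.6] [cite: Tankeev1983, main theorem] -/
theorem codimThreeWeilGeneration_stub_simple_prime_seven_of_tankeevRibet
    (hTR : TankeevRibet1983_hodgeClasses_divisorial_powers_simplePrimeDimension) :
    ∀ A : Literature.AlgebraicGeometry.Motives.AbelianVariety ℂ, A.dim = 7 →
      Literature.AlgebraicGeometry.Motives.AbelianVariety.IsSimple A →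
        ∀ c : Literature.AlgebraicGeometry.HodgeTheory.complexBetti A.X (2 * 3),
          Literature.AlgebraicGeometry.HodgeTheory.IsRationalClass c →
            Literature.AlgebraicGeometry.HodgeTheory.IsOfHodgeType A.dim A.X (2 * 3) 3 3 c →
              c ∈ Literature.Barriers.HodgeConjecture.divisorClassesSpan A.X A.dim 3 :=
  fun A hA hs c hc hH ↦
    hodgeClasses_divisorial_self_of_tankeevRibet hTR A (by norm_num : Nat.Prime 7) hA hs 3 c hc hH

/-- The same sector read as ALGEBRAICITY (what the census route is for): on a simple complex abelian sevenfold
every rational `(3,3)`-class is algebraic, modulo Tankeev–Ribet (`D³ ⊗ ℂ ⊆ N³`, Lefschetz `(1,1)` discharged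
in the tree). [cite: MoonenZarhin1999LowDim, §2 Thm. (2.7)] [cite: vanGeemen1994HodgeAV, Thm. 4.6 and §2.4] -/
theorem hodgeClasses_algebraic_codimThree_simpleSevenfold_of_tankeevRibet
    (hTR : TankeevRibet1983_hodgeClasses_divisorial_powers_simplePrimeDimension)
    (A : AbelianVariety ℂ) (hA : A.dim = 7) (hs : A.IsSimple) (c : complexBetti A.X (2 * 3))
    (hc : IsRationalClass c) (hH : IsOfHodgeType A.dim A.X (2 * 3) 3 3 c) :
    c ∈ algebraicClasses A.X 3 :=
  hodgeClasses_algebraic_self_of_tankeevRibet hTR A (by norm_num : Nat.Prime 7) hA hs 3 c hc hH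

end Summit.HodgeConjecture.HodgeConjecture.Theorems

end
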